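import Summits.CriticalPhenomena.PercolationContinuityZ3.Theorems.PercNearOneGluingNoHeavyLowerTailEGkRefinedResidual
import Summits.CriticalPhenomena.PercolationContinuityZ3.Theorems.PercNearOneGluingNoHeavyLowerTailEventGluingClosure
import HarnessLib

/-! # Crux `PercNearOneGluing.NoHeavyLowerTail` (stmt-CriticalPhenomena-4575) — TYPED k-UNIFORM BRIDGE:
# the refined Kozma–Nitzan residual row `(KNS')_k` at the worst relay, for every `k`, implies the crux

Support file (new-inequality factory seat `prim-ineq-gen-7`; `--supports stmt-CriticalPhenomena-4575`); no definitions, no named facts,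
no sorries.  Composition of `Theorems.EGkResidual.eventGluing_of_refinedResidual` (row ⟹ event gluing `EG_k` with constant 1 on
nondegenerate instances) with the degenerate closure `Theorems.EventGluingClosure.noHeavyLowerTail_of_eventGluingLtOne`
(all weights `< 1` ⟹ every refined conditioning event `N'_O = {O ∪ {o} ↮ A ∖ O}` is non-null, `EventGluingClosure.sep_real_pos`):

* `noHeavyLowerTail_of_refinedResidualK` — **if on every finite weighted graph whose refined conditioning events are non-null the row
  `(KNS')_k : 0 ≤ s + Σ_{∅≠O⊆A∖r} φ'_O (m'_O − m'_{A∖O})` holds at a WORST relay `r`, then `NoHeavyLowerTail`.**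
[cite: KozmaNitzan2024, Theorem 2 (§3.1, pp. 8–9), Conjecture 3 (p. 15); VandenbergHaggstromKahn2005, Thms. 1.3–1.4 (pp. 6–7)]
-/

namespace Summit.CriticalPhenomena.PercolationContinuityZ3.Theorems

open MeasureTheory Set Literature.Probability.LatticeModels Literature.Probability.Percolation

noncomputable section
open Classical

variable {n : ℕ}

namespace EGkResidual

/-- **Typed k-uniform bridge.** `(KNS')_k` at the worst relay on all nondegenerate instances ⟹ `NoHeavyLowerTail`.
[cite: KozmaNitzan2024, Theorem 2 (pp. 8–9), Conjecture 3 (p. 15); VandenbergHaggstromKahn2005, Thms. 1.3–1.4] -/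
theorem noHeavyLowerTail_of_refinedResidualK
    (hKNS : ∀ (n : ℕ) (w : Sym2 (Fin n) → unitInterval) (A : Finset (Fin n)) (o c r : Fin n), r ∈ A → o ∉ A →
      (∀ a ∈ A, (prodBernoulli w).real ((openConn a c : Set (BondConfig (Fin n)))ᶜ) ≤
        (prodBernoulli w).real ((openConn r c : Set (BondConfig (Fin n)))ᶜ)) →
      (∀ O ∈ (A.erase r).powerset.filter (fun O => O.Nonempty),
        0 < (prodBernoulli w).real {ω : BondConfig (Fin n) | ∀ s ∈ insert o O, ∀ x ∈ A \ O, ¬ (openGraph ω).Reachable s x}) →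
      0 ≤ (prodBernoulli w).real ((⋃ a ∈ A, (openConn o a : Set (BondConfig (Fin n))))ᶜ ∩ (openConn r c)ᶜ)
        + ∑ O ∈ (A.erase r).powerset.filter (fun O => O.Nonempty),
          (prodBernoulli w).real ({ω : BondConfig (Fin n) | ∀ s ∈ insert o O, ∀ x ∈ A \ O, ¬ (openGraph ω).Reachable s x} ∩
                ⋃ s ∈ O, (openConn s o : Set (BondConfig (Fin n))))
            / (prodBernoulli w).real {ω : BondConfig (Fin n) | ∀ s ∈ insert o O, ∀ x ∈ A \ O, ¬ (openGraph ω).Reachable s x}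
            * ((prodBernoulli w).real ({ω : BondConfig (Fin n) | ∀ s ∈ insert o O, ∀ x ∈ A \ O, ¬ (openGraph ω).Reachable s x} ∩
                  ⋂ s ∈ O, (openConn s c : Set (BondConfig (Fin n))))
              - (prodBernoulli w).real ({ω : BondConfig (Fin n) | ∀ s ∈ insert o O, ∀ x ∈ A \ O, ¬ (openGraph ω).Reachable s x} ∩
                  ⋂ s ∈ A \ O, (openConn s c : Set (BondConfig (Fin n)))))) :
    Summit.CriticalPhenomena.PercolationContinuityZ3.Theses.PercNearOneGluing.NoHeavyLowerTail := by
  refine EventGluingClosure.noHeavyLowerTail_of_eventGluingLtOne ?_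
  intro n w A o c r hrA hoA hw hrmax
  have hpos : ∀ O ∈ (A.erase r).powerset.filter (fun O => O.Nonempty),
      0 < (prodBernoulli w).real {ω : BondConfig (Fin n) | ∀ s ∈ insert o O, ∀ x ∈ A \ O, ¬ (openGraph ω).Reachable s x} := by
    intro O _
    refine EventGluingClosure.sep_real_pos w hw (insert o O) (A \ O) (Finset.disjoint_left.2 fun s hs hx => ?_)
    rw [Finset.mem_sdiff] at hx
    rcases Finset.mem_insert.1 hs with rfl | hsO
    · exact hoA hx.1
    · exact hx.2 hsO
  exact eventGluing_of_refinedResidual w A o c r hrA hoA hpos (hKNS n w A o c r hrA hoA hrmax hpos)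

end EGkResidual

end

end Summit.CriticalPhenomena.PercolationContinuityZ3.Theorems
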